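import Literature.NumberTheory.Rogawski1990.EndoscopicClassTransfer
import HarnessLib

/-!
# The second level of the §10.1 induction for `U(3)`: the elliptic endoscopic torus `U(1) × U(1) ⊂ U(Φ₂)` and the class transfer
# `U(1) × U(1) × U(1) → H = U(Φ₂) × U(Φ₁)` with fibres of size `≤ 2` (Rogawski 1990, §4.6 Prop. 4.6.1, Prop. 5.3.1, §5.4 pp. 72–73, §10.1)

Topic `NumberTheory/Rogawski1990`; namespace `Literature.NumberTheory.Rogawski1990`; DEFINITIONS with bodies + theorems; no named fact, no `sorry`,
no instance, no notation.  On top of ★ `EndoscopicClassTransfer` (T1b-4: `StableClassH σ J₂ J₁`, `stableClassHOf`, `fst`, `sndVal`) and ★ `StableConjugacyU3`.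

[Rogawski1990, §10.1]: `SJ_G(𝒪_st, f)` is defined INDUCTIVELY through «the unique proper elliptic endoscopic group» — for `G = U(3)`: `H = U(2) × U(1)`;
for `H` (its `U(2)`-factor): the anisotropic torus `U(1) × U(1)` [§4.6; Prop. 5.3.1: `i(U(2), U(1) × U(1)) = ¼`], whose stable classes are its elements
(abelian — the base of the induction, `SJ = J`, ★ `stabilize_zero` of T1b-7).  [§5.4 pp. 72–73]: over a stable class of a Cartan subgroup of type (1) the
classes upstairs are governed by the Weyl-group ambiguity (here: `(u₁, u₂) ↔ (u₂, u₁)`).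

* §1 (field `K` with `2 ≠ 0`) **`torusMatrix u₁ u₂ = ½ (u₁+u₂, u₁−u₂; u₁−u₂, u₁+u₂) = P diag(u₁, u₂) P⁻¹`**, `P = (1 1; 1 −1)` (the rational frame with
  `ᵗ(σP) Φ₂ P = diag(2, −2)`): multiplicative, `det = u₁u₂`, `charpoly = (X − u₁)(X − u₂)`; **`torusGL : GL₁ × GL₁ →* GL₂`**; UNITARITY for
  `Φ₂ = antidiag(1, 1)` when `σ(u_i) u_i = 1` (`torusGL_mem_unitaryGroup`) and **`torusEmb₂ : U(σ, Φ₁) × U(σ, Φ₁) →* U(σ, Φ₂)`**;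
* §2 the torus `T = U(σ, Φ₁)³` (its stable classes are its elements) and **`TransfersTo₂ u 𝒪′ :⟺ 𝒪′_st(torusEmb₂ (u₁, u₂), u₃) = 𝒪′`** into
  `StableClassH σ Φ₂ Φ₁`; right-unique; `charpoly (fst 𝒪′) = (X − u₁)(X − u₂)`, `sndVal 𝒪′ = u₃`;
* §3 FIBRES: on `{u | TransfersTo₂ u 𝒪′}` the map `u ↦ u₁` is injective (`u₂` is the other root of `charpoly (fst 𝒪′)`, `u₃ = sndVal 𝒪′`) with values in
  the `≤ 2` roots: **`finite_setOf_transfersTo₂`, `ncard_setOf_transfersTo₂_le_two`, `Finite {u // TransfersTo₂ u 𝒪′}`** — so T1b-7's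
  `stabilize TransfersTo₂ i J_H J_T` is a finite correction and `SJ_H := stabilize TransfersTo₂ ¼ J_H J_T` is pinnable with an INPUT `J_T` on the torus.
-/

noncomputable section

namespace Literature.NumberTheory.Rogawski1990

open scoped MatrixGroups Matrix
open Polynomial
open Literature.AlgebraicGeometry.ShimuraVarieties (unitaryGroup mem_unitaryGroup_iff)

section Field

variable {K : Type*} [Field K] [NeZero (2 : K)]

/-! ## §1 The torus `U(1) × U(1)` inside `U(Φ₂)` through the frame `P = (1 1; 1 −1)` -/

/-- The matrix `½ (u₁+u₂, u₁−u₂; u₁−u₂, u₁+u₂) = P · diag(u₁, u₂) · P⁻¹`, `P = (1 1; 1 −1)` (`P⁻¹ = ½ P`). [cite: Rogawski1990, §4.6 Prop. 4.6.1] -/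
def torusMatrix (u₁ u₂ : K) : Matrix (Fin 2) (Fin 2) K :=
  !![(u₁ + u₂) / 2, (u₁ - u₂) / 2; (u₁ - u₂) / 2, (u₁ + u₂) / 2]

omit [NeZero (2 : K)] in
/-- Entries. [cite: Rogawski1990, §4.6 Prop. 4.6.1] -/
theorem torusMatrix_eq (u₁ u₂ : K) : torusMatrix u₁ u₂ = !![(u₁ + u₂) / 2, (u₁ - u₂) / 2; (u₁ - u₂) / 2, (u₁ + u₂) / 2] := rfl

/-- `torusMatrix 1 1 = 1`. [cite: Rogawski1990, §4.6 Prop. 4.6.1] -/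
theorem torusMatrix_one : torusMatrix (1 : K) 1 = 1 := by
  have h2 : (2 : K) ≠ 0 := NeZero.ne 2
  ext i j; fin_cases i <;> fin_cases j <;> simp [torusMatrix]

/-- Multiplicativity: `M(u₁, u₂) M(v₁, v₂) = M(u₁v₁, u₂v₂)` (conjugates of diagonal matrices). [cite: Rogawski1990, §4.6 Prop. 4.6.1] -/
theorem torusMatrix_mul (u₁ u₂ v₁ v₂ : K) : torusMatrix u₁ u₂ * torusMatrix v₁ v₂ = torusMatrix (u₁ * v₁) (u₂ * v₂) := by
  have h2 : (2 : K) ≠ 0 := NeZero.ne 2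
  ext i j; fin_cases i <;> fin_cases j <;> simp [torusMatrix, Matrix.mul_apply, Fin.sum_univ_two] <;> field_simp <;> ring

/-- `det M(u₁, u₂) = u₁ u₂`. [cite: Rogawski1990, §4.6 Prop. 4.6.1] -/
theorem det_torusMatrix (u₁ u₂ : K) : (torusMatrix u₁ u₂).det = u₁ * u₂ := by
  have h2 : (2 : K) ≠ 0 := NeZero.ne 2
  rw [torusMatrix, Matrix.det_fin_two_of]
  field_simp
  ring

/-- `charpoly M(u₁, u₂) = (X − u₁)(X − u₂)`. [cite: Rogawski1990, §4.6 Prop. 4.6.1] -/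
theorem charpoly_torusMatrix (u₁ u₂ : K) : (torusMatrix u₁ u₂).charpoly = (X - C u₁) * (X - C u₂) := by
  have h2 : (2 : K) ≠ 0 := NeZero.ne 2
  rw [Matrix.charpoly_fin_two, det_torusMatrix, torusMatrix, Matrix.trace_fin_two_of]
  have ht : (u₁ + u₂) / 2 + (u₁ + u₂) / 2 = u₁ + u₂ := by field_simp; ring
  rw [ht, map_add, map_mul]
  ring

/-- **`torusGL : GL₁(K) × GL₁(K) →* GL₂(K)`, `(u₁, u₂) ↦ P diag(u₁, u₂) P⁻¹`** (entries read through `det : GL₁ → Kˣ`). [cite: Rogawski1990, §4.6 Prop. 4.6.1] -/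
def torusGL : GL (Fin 1) K × GL (Fin 1) K →* GL (Fin 2) K where
  toFun u :=
    ⟨torusMatrix (Matrix.GeneralLinearGroup.det u.1 : K) (Matrix.GeneralLinearGroup.det u.2 : K),
      torusMatrix ((Matrix.GeneralLinearGroup.det u.1)⁻¹ : Kˣ) ((Matrix.GeneralLinearGroup.det u.2)⁻¹ : Kˣ),
      by rw [torusMatrix_mul, Units.mul_inv, Units.mul_inv, torusMatrix_one],
      by rw [torusMatrix_mul, Units.inv_mul, Units.inv_mul, torusMatrix_one]⟩
  map_one' := Units.ext (by simp only [Prod.fst_one, Prod.snd_one, map_one, Units.val_one, torusMatrix_one])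
  map_mul' u v := Units.ext (by
    simp only [Prod.fst_mul, Prod.snd_mul, map_mul, Units.val_mul, torusMatrix_mul])

/-- The matrix of `torusGL (u₁, u₂)`. [cite: Rogawski1990, §4.6 Prop. 4.6.1] -/
theorem coe_torusGL (u : GL (Fin 1) K × GL (Fin 1) K) :
    ((torusGL u : GL (Fin 2) K) : Matrix (Fin 2) (Fin 2) K) =
      torusMatrix (Matrix.GeneralLinearGroup.det u.1 : K) (Matrix.GeneralLinearGroup.det u.2 : K) := rfl

omit [NeZero (2 : K)] in
/-- `det : GL₁(K) → Kˣ` is the entry: `↑(det u) = u₀₀`. [folklore] -/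
private theorem coe_det_fin_one (u : GL (Fin 1) K) : (Matrix.GeneralLinearGroup.det u : K) = (u : Matrix (Fin 1) (Fin 1) K) 0 0 := by
  rw [Matrix.GeneralLinearGroup.val_det_apply, Matrix.det_fin_one]

/-- `charpoly (torusGL (u₁, u₂)) = (X − u₁)(X − u₂)` with `u_i` the entries. [cite: Rogawski1990, §4.6 Prop. 4.6.1] -/
theorem charpoly_torusGL (u : GL (Fin 1) K × GL (Fin 1) K) :
    ((torusGL u : GL (Fin 2) K) : Matrix (Fin 2) (Fin 2) K).charpoly =
      (X - C ((u.1 : Matrix (Fin 1) (Fin 1) K) 0 0)) * (X - C ((u.2 : Matrix (Fin 1) (Fin 1) K) 0 0)) := by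
  rw [coe_torusGL, charpoly_torusMatrix, coe_det_fin_one, coe_det_fin_one]

variable (σ : K →+* K)

omit [NeZero (2 : K)] in
/-- `u ∈ U(σ, Φ₁)` (`Φ₁ = (1)`) iff `σ(u₀₀) · u₀₀ = 1`. [cite: Rogawski1990, §4.6 Prop. 4.6.1] -/
theorem mem_unitaryGroup_fin_one_iff (u : GL (Fin 1) K) :
    u ∈ unitaryGroup σ (Matrix.of fun i j : Fin 1 => if i.val + j.val + 1 = 1 then (1 : K) else 0) ↔
      σ ((u : Matrix (Fin 1) (Fin 1) K) 0 0) * (u : Matrix (Fin 1) (Fin 1) K) 0 0 = 1 := by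
  rw [mem_unitaryGroup_iff]
  constructor
  · intro h
    have e := congrFun (congrFun h 0) 0
    simpa [Matrix.mul_apply, Matrix.of_apply] using e
  · intro h
    ext i j; fin_cases i; fin_cases j
    simpa [Matrix.mul_apply, Matrix.of_apply] using h

/-- **UNITARITY**: if `σ(u₁)u₁ = σ(u₂)u₂ = 1` then `M(u₁, u₂)` preserves `Φ₂ = antidiag(1, 1)`: `ᵗ(σM) Φ₂ M = Φ₂` (the frame `P` takes `Φ₂` to `diag(2, −2)`,
where `diag(u₁, u₂)` is unitary). [cite: Rogawski1990, §4.6 Prop. 4.6.1] -/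
theorem conjTranspose_torusMatrix_mul {u₁ u₂ : K} (h₁ : σ u₁ * u₁ = 1) (h₂ : σ u₂ * u₂ = 1) :
    ((torusMatrix u₁ u₂).map σ)ᵀ * (Matrix.of fun i j : Fin 2 => if i.val + j.val + 1 = 2 then (1 : K) else 0) * torusMatrix u₁ u₂ =
      Matrix.of fun i j : Fin 2 => if i.val + j.val + 1 = 2 then (1 : K) else 0 := by
  have h2 : (2 : K) ≠ 0 := NeZero.ne 2
  have hσ2 : σ 2 = 2 := map_ofNat σ 2
  ext i j; fin_cases i <;> fin_cases j <;>
    simp [torusMatrix, Matrix.mul_apply, Fin.sum_univ_two, Matrix.of_apply, map_div₀, hσ2] <;> field_simp <;>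
    first
      | linear_combination h₁ + h₂
      | linear_combination h₁ - h₂
      | linear_combination h₂ - h₁
      | linear_combination 2 * h₁ + 2 * h₂
      | linear_combination 2 * h₁ - 2 * h₂

/-- **`torusGL (u₁, u₂) ∈ U(σ, Φ₂)` for `u₁, u₂ ∈ U(σ, Φ₁)`.** [cite: Rogawski1990, §4.6 Prop. 4.6.1] -/
theorem torusGL_mem_unitaryGroup {u₁ u₂ : GL (Fin 1) K}
    (h₁ : u₁ ∈ unitaryGroup σ (Matrix.of fun i j : Fin 1 => if i.val + j.val + 1 = 1 then (1 : K) else 0))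
    (h₂ : u₂ ∈ unitaryGroup σ (Matrix.of fun i j : Fin 1 => if i.val + j.val + 1 = 1 then (1 : K) else 0)) :
    torusGL (u₁, u₂) ∈ unitaryGroup σ (Matrix.of fun i j : Fin 2 => if i.val + j.val + 1 = 2 then (1 : K) else 0) := by
  rw [mem_unitaryGroup_iff, coe_torusGL, coe_det_fin_one, coe_det_fin_one]
  exact conjTranspose_torusMatrix_mul σ ((mem_unitaryGroup_fin_one_iff σ u₁).mp h₁) ((mem_unitaryGroup_fin_one_iff σ u₂).mp h₂)

/-- **The elliptic endoscopic torus `torusEmb₂ : U(σ, Φ₁) × U(σ, Φ₁) →* U(σ, Φ₂)`, `(u₁, u₂) ↦ P diag(u₁, u₂) P⁻¹`.** [cite: Rogawski1990, §4.6 Prop. 4.6.1] -/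
def torusEmb₂ :
    ↥(unitaryGroup σ (Matrix.of fun i j : Fin 1 => if i.val + j.val + 1 = 1 then (1 : K) else 0)) ×
        ↥(unitaryGroup σ (Matrix.of fun i j : Fin 1 => if i.val + j.val + 1 = 1 then (1 : K) else 0)) →*
      ↥(unitaryGroup σ (Matrix.of fun i j : Fin 2 => if i.val + j.val + 1 = 2 then (1 : K) else 0)) :=
  (torusGL.comp ((unitaryGroup σ (Matrix.of fun i j : Fin 1 => if i.val + j.val + 1 = 1 then (1 : K) else 0)).subtype.prodMap
    (unitaryGroup σ (Matrix.of fun i j : Fin 1 => if i.val + j.val + 1 = 1 then (1 : K) else 0)).subtype)).codRestrict _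
    fun u => torusGL_mem_unitaryGroup σ u.1.2 u.2.2

/-- `torusEmb₂ (u₁, u₂) = torusGL (u₁, u₂)` in `GL₂`. [cite: Rogawski1990, §4.6 Prop. 4.6.1] -/
@[simp] theorem coe_torusEmb₂
    (u : ↥(unitaryGroup σ (Matrix.of fun i j : Fin 1 => if i.val + j.val + 1 = 1 then (1 : K) else 0)) ×
      ↥(unitaryGroup σ (Matrix.of fun i j : Fin 1 => if i.val + j.val + 1 = 1 then (1 : K) else 0))) :
    ((torusEmb₂ σ u : ↥(unitaryGroup σ (Matrix.of fun i j : Fin 2 => if i.val + j.val + 1 = 2 then (1 : K) else 0))) : GL (Fin 2) K) =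
      torusGL ((u.1 : GL (Fin 1) K), (u.2 : GL (Fin 1) K)) := rfl

/-! ## §2 The class transfer `U(Φ₁)³ → StableClassH σ Φ₂ Φ₁`, `(u₁, u₂, u₃) ↦ 𝒪′_st(torusEmb₂ (u₁, u₂), u₃)` -/

/-- **`(u₁, u₂, u₃)` TRANSFERS TO the stable class `𝒪′` of `H = U(Φ₂) × U(Φ₁)`** iff `𝒪′` is the stable class of `(torusEmb₂ (u₁, u₂), u₃)` (the torus
`T = U(Φ₁)³` is abelian: its stable classes are its elements; the image is defined up to stable conjugacy, so the choice of frame `P` is immaterial).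
[cite: Rogawski1990, §10.1] -/
def TransfersTo₂
    (u : ↥(unitaryGroup σ (Matrix.of fun i j : Fin 1 => if i.val + j.val + 1 = 1 then (1 : K) else 0)) ×
      (↥(unitaryGroup σ (Matrix.of fun i j : Fin 1 => if i.val + j.val + 1 = 1 then (1 : K) else 0)) ×
        ↥(unitaryGroup σ (Matrix.of fun i j : Fin 1 => if i.val + j.val + 1 = 1 then (1 : K) else 0))))
    (c' : StableClassH σ (Matrix.of fun i j : Fin 2 => if i.val + j.val + 1 = 2 then (1 : K) else 0)
      (Matrix.of fun i j : Fin 1 => if i.val + j.val + 1 = 1 then (1 : K) else 0)) : Prop :=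
  stableClassHOf σ _ _ (torusEmb₂ σ (u.1, u.2.1), u.2.2) = c'

variable {σ}

/-- A torus element transfers to exactly one stable class of `H`. [cite: Rogawski1990, §10.1] -/
theorem TransfersTo₂.right_unique
    {u : ↥(unitaryGroup σ (Matrix.of fun i j : Fin 1 => if i.val + j.val + 1 = 1 then (1 : K) else 0)) ×
      (↥(unitaryGroup σ (Matrix.of fun i j : Fin 1 => if i.val + j.val + 1 = 1 then (1 : K) else 0)) ×
        ↥(unitaryGroup σ (Matrix.of fun i j : Fin 1 => if i.val + j.val + 1 = 1 then (1 : K) else 0)))}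
    {c'₁ c'₂ : StableClassH σ (Matrix.of fun i j : Fin 2 => if i.val + j.val + 1 = 2 then (1 : K) else 0)
      (Matrix.of fun i j : Fin 1 => if i.val + j.val + 1 = 1 then (1 : K) else 0)}
    (h₁ : TransfersTo₂ σ u c'₁) (h₂ : TransfersTo₂ σ u c'₂) : c'₁ = c'₂ :=
  h₁.symm.trans h₂

/-- The characteristic polynomial of the `U(Φ₂)`-component of a class hit by `(u₁, u₂, u₃)` is `(X − u₁)(X − u₂)`. [cite: Rogawski1990, §5.4 pp. 72–73] -/
theorem TransfersTo₂.charpoly_fst_eq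
    {u : ↥(unitaryGroup σ (Matrix.of fun i j : Fin 1 => if i.val + j.val + 1 = 1 then (1 : K) else 0)) ×
      (↥(unitaryGroup σ (Matrix.of fun i j : Fin 1 => if i.val + j.val + 1 = 1 then (1 : K) else 0)) ×
        ↥(unitaryGroup σ (Matrix.of fun i j : Fin 1 => if i.val + j.val + 1 = 1 then (1 : K) else 0)))}
    {c' : StableClassH σ (Matrix.of fun i j : Fin 2 => if i.val + j.val + 1 = 2 then (1 : K) else 0)
      (Matrix.of fun i j : Fin 1 => if i.val + j.val + 1 = 1 then (1 : K) else 0)}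
    (h : TransfersTo₂ σ u c') :
    c'.fst.charpoly = (X - C (((u.1 : GL (Fin 1) K) : Matrix (Fin 1) (Fin 1) K) 0 0)) *
      (X - C (((u.2.1 : GL (Fin 1) K) : Matrix (Fin 1) (Fin 1) K) 0 0)) := by
  rw [← h, StableClassH.fst_stableClassHOf, StableClass.charpoly_stableClassOf, coe_torusEmb₂, charpoly_torusGL]

/-- The `U(Φ₁)`-component of a class hit by `(u₁, u₂, u₃)` is `u₃`. [cite: Rogawski1990, §5.4 pp. 72–73] -/
theorem TransfersTo₂.sndVal_eq
    {u : ↥(unitaryGroup σ (Matrix.of fun i j : Fin 1 => if i.val + j.val + 1 = 1 then (1 : K) else 0)) ×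
      (↥(unitaryGroup σ (Matrix.of fun i j : Fin 1 => if i.val + j.val + 1 = 1 then (1 : K) else 0)) ×
        ↥(unitaryGroup σ (Matrix.of fun i j : Fin 1 => if i.val + j.val + 1 = 1 then (1 : K) else 0)))}
    {c' : StableClassH σ (Matrix.of fun i j : Fin 2 => if i.val + j.val + 1 = 2 then (1 : K) else 0)
      (Matrix.of fun i j : Fin 1 => if i.val + j.val + 1 = 1 then (1 : K) else 0)}
    (h : TransfersTo₂ σ u c') : c'.sndVal = (((u.2.2 : GL (Fin 1) K)) : Matrix (Fin 1) (Fin 1) K) 0 0 := by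
  rw [← h, StableClassH.sndVal_stableClassHOf]

/-! ## §3 The fibres: at most two torus elements over a stable class of `H` -/

omit [NeZero (2 : K)] in
/-- A `1 × 1` invertible matrix is its entry. [folklore] -/
private theorem GL_fin_one_eq_of_apply_eq {x y : GL (Fin 1) K} (h : (x : Matrix (Fin 1) (Fin 1) K) 0 0 = (y : Matrix (Fin 1) (Fin 1) K) 0 0) :
    x = y := by
  refine Units.ext (Matrix.ext fun i j => ?_)
  fin_cases i; fin_cases j
  exact h

omit [NeZero (2 : K)] in
/-- Cancelling a monic linear factor: `(X − a)(X − b) = (X − a)(X − b′) ⇒ b = b′`. [folklore] -/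
private theorem eq_of_mul_X_sub_C_eq {a b b' : K} (h : (X - C a) * (X - C b) = (X - C a) * (X - C b')) : b = b' := by
  have h' := mul_left_cancel₀ (X_sub_C_ne_zero a) h
  have := congrArg (fun p : K[X] => p.eval 0) h'
  simp only [eval_sub, eval_X, eval_C, zero_sub, neg_inj] at this
  exact this

/-- **A transferring torus element is determined by the target class and its first coordinate** (`u₂` is the other root of `charpoly (fst 𝒪′)`,
`u₃ = sndVal 𝒪′`). [cite: Rogawski1990, §5.4 pp. 72–73] -/
theorem TransfersTo₂.eq_of_fst_apply_eq
    {u u' : ↥(unitaryGroup σ (Matrix.of fun i j : Fin 1 => if i.val + j.val + 1 = 1 then (1 : K) else 0)) ×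
      (↥(unitaryGroup σ (Matrix.of fun i j : Fin 1 => if i.val + j.val + 1 = 1 then (1 : K) else 0)) ×
        ↥(unitaryGroup σ (Matrix.of fun i j : Fin 1 => if i.val + j.val + 1 = 1 then (1 : K) else 0)))}
    {c' : StableClassH σ (Matrix.of fun i j : Fin 2 => if i.val + j.val + 1 = 2 then (1 : K) else 0)
      (Matrix.of fun i j : Fin 1 => if i.val + j.val + 1 = 1 then (1 : K) else 0)}
    (h : TransfersTo₂ σ u c') (h' : TransfersTo₂ σ u' c')
    (he : ((u.1 : GL (Fin 1) K) : Matrix (Fin 1) (Fin 1) K) 0 0 = ((u'.1 : GL (Fin 1) K) : Matrix (Fin 1) (Fin 1) K) 0 0) : u = u' := by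
  have hc := h.charpoly_fst_eq.symm.trans h'.charpoly_fst_eq
  rw [he] at hc
  have h2 := eq_of_mul_X_sub_C_eq hc
  have h3 := h.sndVal_eq.symm.trans h'.sndVal_eq
  refine Prod.ext (Subtype.ext (GL_fin_one_eq_of_apply_eq he)) (Prod.ext (Subtype.ext (GL_fin_one_eq_of_apply_eq h2))
    (Subtype.ext (GL_fin_one_eq_of_apply_eq h3)))

/-- `u ↦ u₁` is injective on the fibre over `𝒪′`. [cite: Rogawski1990, §5.4 pp. 72–73] -/
theorem injOn_fst_apply_setOf_transfersTo₂
    (c' : StableClassH σ (Matrix.of fun i j : Fin 2 => if i.val + j.val + 1 = 2 then (1 : K) else 0)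
      (Matrix.of fun i j : Fin 1 => if i.val + j.val + 1 = 1 then (1 : K) else 0)) :
    Set.InjOn (fun u : ↥(unitaryGroup σ (Matrix.of fun i j : Fin 1 => if i.val + j.val + 1 = 1 then (1 : K) else 0)) ×
        (↥(unitaryGroup σ (Matrix.of fun i j : Fin 1 => if i.val + j.val + 1 = 1 then (1 : K) else 0)) ×
          ↥(unitaryGroup σ (Matrix.of fun i j : Fin 1 => if i.val + j.val + 1 = 1 then (1 : K) else 0))) =>
        ((u.1 : GL (Fin 1) K) : Matrix (Fin 1) (Fin 1) K) 0 0) {u | TransfersTo₂ σ u c'} :=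
  fun _ h _ h' he => TransfersTo₂.eq_of_fst_apply_eq h h' he

/-- `u₁` is a root of `charpoly (fst 𝒪′)`, which has at most `2` roots. [cite: Rogawski1990, §5.4 pp. 72–73] -/
theorem mapsTo_fst_apply_setOf_transfersTo₂ [DecidableEq K]
    (c' : StableClassH σ (Matrix.of fun i j : Fin 2 => if i.val + j.val + 1 = 2 then (1 : K) else 0)
      (Matrix.of fun i j : Fin 1 => if i.val + j.val + 1 = 1 then (1 : K) else 0)) :
    Set.MapsTo (fun u : ↥(unitaryGroup σ (Matrix.of fun i j : Fin 1 => if i.val + j.val + 1 = 1 then (1 : K) else 0)) ×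
        (↥(unitaryGroup σ (Matrix.of fun i j : Fin 1 => if i.val + j.val + 1 = 1 then (1 : K) else 0)) ×
          ↥(unitaryGroup σ (Matrix.of fun i j : Fin 1 => if i.val + j.val + 1 = 1 then (1 : K) else 0))) =>
        ((u.1 : GL (Fin 1) K) : Matrix (Fin 1) (Fin 1) K) 0 0) {u | TransfersTo₂ σ u c'} ↑c'.fst.charpoly.roots.toFinset := by
  intro u hu
  have hne : c'.fst.charpoly ≠ 0 := by
    obtain ⟨b, hb⟩ := stableClassOf_surjective c'.fst
    rw [← hb]
    exact (Matrix.charpoly_monic _).ne_zero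
  rw [Finset.mem_coe, Multiset.mem_toFinset, Polynomial.mem_roots hne, TransfersTo₂.charpoly_fst_eq hu, Polynomial.IsRoot, eval_mul, eval_sub,
    eval_X, eval_C, sub_self, zero_mul]

omit [NeZero (2 : K)] in
/-- `charpoly (fst 𝒪′)` has at most `2` distinct roots. [cite: Rogawski1990, §5.4 pp. 72–73] -/
theorem StableClass.card_roots_charpoly_toFinset_le_two [DecidableEq K]
    (c : StableClass σ (Matrix.of fun i j : Fin 2 => if i.val + j.val + 1 = 2 then (1 : K) else 0)) : c.charpoly.roots.toFinset.card ≤ 2 := by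
  obtain ⟨b, rfl⟩ := stableClassOf_surjective c
  calc (((b : GL (Fin 2) K) : Matrix (Fin 2) (Fin 2) K).charpoly.roots.toFinset).card
      ≤ Multiset.card ((b : GL (Fin 2) K) : Matrix (Fin 2) (Fin 2) K).charpoly.roots := Multiset.toFinset_card_le _
    _ ≤ ((b : GL (Fin 2) K) : Matrix (Fin 2) (Fin 2) K).charpoly.natDegree := Polynomial.card_roots' _
    _ = 2 := by rw [Matrix.charpoly_natDegree_eq_dim, Fintype.card_fin]

/-- **FINITENESS of the fibres of the second-level transfer.** [cite: Rogawski1990, §10.1] -/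
theorem finite_setOf_transfersTo₂
    (c' : StableClassH σ (Matrix.of fun i j : Fin 2 => if i.val + j.val + 1 = 2 then (1 : K) else 0)
      (Matrix.of fun i j : Fin 1 => if i.val + j.val + 1 = 1 then (1 : K) else 0)) :
    {u | TransfersTo₂ σ u c'}.Finite := by
  classical
  exact Set.Finite.of_finite_image ((Finset.finite_toSet _).subset (mapsTo_fst_apply_setOf_transfersTo₂ c').image_subset)
    (injOn_fst_apply_setOf_transfersTo₂ c')

/-- **AT MOST TWO torus elements transfer to a given stable class of `H`** (the Weyl ambiguity `(u₁, u₂) ↔ (u₂, u₁)`). [cite: Rogawski1990, §5.4 pp. 72–73] -/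
theorem ncard_setOf_transfersTo₂_le_two
    (c' : StableClassH σ (Matrix.of fun i j : Fin 2 => if i.val + j.val + 1 = 2 then (1 : K) else 0)
      (Matrix.of fun i j : Fin 1 => if i.val + j.val + 1 = 1 then (1 : K) else 0)) :
    {u | TransfersTo₂ σ u c'}.ncard ≤ 2 := by
  classical
  calc {u | TransfersTo₂ σ u c'}.ncard ≤ (↑c'.fst.charpoly.roots.toFinset : Set K).ncard :=
        Set.ncard_le_ncard_of_injOn _ (mapsTo_fst_apply_setOf_transfersTo₂ c') (injOn_fst_apply_setOf_transfersTo₂ c') (Finset.finite_toSet _)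
    _ = c'.fst.charpoly.roots.toFinset.card := Set.ncard_coe_finset _
    _ ≤ 2 := StableClass.card_roots_charpoly_toFinset_le_two c'.fst

/-- The index type of `Σ_{u ↦ 𝒪′}` is finite (so ★ T1b-7's `stabilize TransfersTo₂ i J_H J_T` is a finite correction). [cite: Rogawski1990, §10.1] -/
theorem finite_subtype_transfersTo₂
    (c' : StableClassH σ (Matrix.of fun i j : Fin 2 => if i.val + j.val + 1 = 2 then (1 : K) else 0)
      (Matrix.of fun i j : Fin 1 => if i.val + j.val + 1 = 1 then (1 : K) else 0)) :
    Finite {u // TransfersTo₂ σ u c'} :=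
  (finite_setOf_transfersTo₂ c').to_subtype

/-- … with at most `2` elements. [cite: Rogawski1990, §5.4 pp. 72–73] -/
theorem natCard_subtype_transfersTo₂_le_two
    (c' : StableClassH σ (Matrix.of fun i j : Fin 2 => if i.val + j.val + 1 = 2 then (1 : K) else 0)
      (Matrix.of fun i j : Fin 1 => if i.val + j.val + 1 = 1 then (1 : K) else 0)) :
    Nat.card {u // TransfersTo₂ σ u c'} ≤ 2 :=
  ncard_setOf_transfersTo₂_le_two c'

end Field

end Literature.NumberTheory.Rogawski1990
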